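import Literature.AlgebraicGeometry.Resolution.H0InvertibleTimesZeroDimensional
import Mathlib.AlgebraicGeometry.FunctionField
import HarnessLib

/-!
# Lipman's bi-additivity `(E·(F+G)) = (E·F) + (E·G)` in `h⁰`-form, for `F`, `G` without common component
# (Lipman 1969, Prop. (13.1) b), second equation, with d))

Topic: `Literature/AlgebraicGeometry/Resolution`.  PROVED, fact-free, definition-free.  J. Lipman, *Rational
singularities …*, Publ. Math. IHÉS 36 (1969), Prop. (13.1) b) (p. 223): "`(D·(E+F)) = (D·E) + (D·F)`", which with d)
("`(F·E) = χ(E) + χ(F) − χ(E+F)`") and `χ = h⁰` is the tree's named fact `Lipman1969_13_1_b_rat`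
(`Resolution/Lipman1969IntersectionTheory`): `⟨𝓘, 𝓙𝓚⟩ = ⟨𝓘,𝓙⟩ + ⟨𝓘,𝓚⟩` for `⟨𝓐,𝓑⟩ := h⁰(𝒪/𝓐) + h⁰(𝒪/𝓑) − h⁰(𝒪/𝓐𝓑)`.
Written without subtraction this is the symmetric CUBE IDENTITY

  `h⁰(𝒪/𝓙𝓚) + h⁰(𝒪/𝓘𝓙) + h⁰(𝒪/𝓘𝓚) = h⁰(𝒪/𝓘) + h⁰(𝒪/𝓙) + h⁰(𝒪/𝓚) + h⁰(𝒪/𝓘𝓙𝓚)`,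

proved here for `𝓘` invertible and `𝓙`, `𝓚` "without common component" — `𝓙 ∩ 𝓚 = 𝓙𝓚` and `V(𝓙 + 𝓚)` a finite set
of closed points — on a resolution of a two-dimensional Noetherian local domain with `H¹(X, 𝒪_X) = 0`, from
inclusion–exclusion (`Resolution/RationalResolutionH0InclusionExclusion`: `h⁰(𝒪/(𝓐∩𝓑)) + h⁰(𝒪/(𝓐+𝓑)) = h⁰(𝒪/𝓐) + h⁰(𝒪/𝓑)`,
applied to `(𝓙, 𝓚)` and to `(𝓘𝓙, 𝓘𝓚)`, where `𝓘𝓙 ∩ 𝓘𝓚 = 𝓘(𝓙 ∩ 𝓚)` for the invertible `𝓘`) and the twist formula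
`h⁰(𝒪/𝓘(𝓙+𝓚)) = h⁰(𝒪/𝓘) + h⁰(𝒪/(𝓙+𝓚))` (`Resolution/H0InvertibleTimesZeroDimensional`).

* `mul_inf_eq_of_isEffectiveCartier` — `𝓘(𝓙 ∩ 𝓚) = 𝓘𝓙 ∩ 𝓘𝓚` for an invertible ideal sheaf `𝓘` on an integral scheme;
* **`IsResolution.h0_cube_identity`** — the displayed identity.

What is NOT here: the case of `𝓙`, `𝓚` WITH common components (e.g. `⟨𝓘_E, 𝓘_E · 𝓘_E⟩ = 2⟨𝓘_E, 𝓘_E⟩`, the degree of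
the conormal sheaf), needed for `Lipman1969_13_1_b_rat` in full; and the unpacking of "products of distinct exceptional
primes" into the two hypotheses (`𝓙 ∩ 𝓚 = 𝓙𝓚`, finiteness of `V(𝓙+𝓚)`; cf. `Resolution/PrimeDivisorIdealsIntersection`,
`Resolution/ExceptionalCurveIntersectionH0` §2).

## References
* J. Lipman, Publ. Math. IHÉS 36 (1969), Prop. (13.1) b), d) and proof (p. 223). [Lipman1969]
* U. Görtz, T. Wedhorn, *Algebraic Geometry I* (2nd ed. 2020), Thm. 11.40. [GortzWedhorn2020]
-/

noncomputable section

open CategoryTheory AlgebraicGeometry TopologicalSpace IsLocalRing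
open Literature.AlgebraicGeometry.Morphisms Literature.AlgebraicGeometry.Motives
open Scheme.IdealSheafData

universe u

namespace Literature.AlgebraicGeometry.Resolution

/-! ## §1 `𝓘(𝓙 ∩ 𝓚) = 𝓘𝓙 ∩ 𝓘𝓚` for invertible `𝓘` -/

/-- **`𝓘(𝓙 ∩ 𝓚) = 𝓘𝓙 ∩ 𝓘𝓚` for an invertible ideal sheaf `𝓘`** on an integral scheme (stalkwise `𝓘_x = (t)` with `t`
a non-zero-divisor, and `t(J ∩ K) = tJ ∩ tK`). [cite: GortzWedhorn2020, Thm. 11.40] -/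
theorem mul_inf_eq_of_isEffectiveCartier {X : Scheme.{u}} [IsIntegral X] (𝓘 𝓙 𝓚 : X.IdealSheafData)
    (hI : IsEffectiveCartier 𝓘) : 𝓘 * (𝓙 ⊓ 𝓚) = 𝓘 * 𝓙 ⊓ (𝓘 * 𝓚) := by
  apply le_antisymm
  · exact le_inf (fun U => Ideal.mul_mono_right inf_le_left) (fun U => Ideal.mul_mono_right inf_le_right)
  · refine le_of_forall_stalkIdeal_le fun x => ?_
    rw [stalkIdeal_inf, stalkIdeal_mul, stalkIdeal_mul, stalkIdeal_mul, stalkIdeal_inf, ← span_germ_cartierGen 𝓘 hI x]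
    set t := X.presheaf.germ (CartierDivisor.cartierChart 𝓘 hI x : X.Opens) x
      (CartierDivisor.mem_cartierChart 𝓘 hI x) (CartierDivisor.cartierGen 𝓘 hI x) with ht
    have ht0 : t ≠ 0 := fun h0 => CartierDivisor.cartierGen_ne_zero 𝓘 hI x
      (AlgebraicGeometry.germ_injective_of_isIntegral (X := X) x (CartierDivisor.mem_cartierChart 𝓘 hI x)
        (by rw [map_zero]; exact h0))
    rintro z ⟨hzJ, hzK⟩
    rw [SetLike.mem_coe, Ideal.mem_span_singleton_mul] at hzJ hzK
    obtain ⟨j, hj, hjz⟩ := hzJ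
    obtain ⟨k, hk, hkz⟩ := hzK
    have hjk : j = k := mul_left_cancel₀ ht0 (hjz.trans hkz.symm)
    rw [Ideal.mem_span_singleton_mul]
    exact ⟨j, ⟨hj, hjk ▸ hk⟩, hjz⟩

/-! ## §2 The cube identity -/

/-- **Lipman's (13.1) b)+d) in `h⁰`-form for curves without common component (cube identity)**: on a resolution
`π : X → Spec A` of a two-dimensional Noetherian local domain with `H¹(X, 𝒪_X) = 0`, for an invertible ideal sheaf `𝓘`
and ideal sheaves `𝓙`, `𝓚` with `𝓙 ∩ 𝓚 = 𝓙𝓚` and `V(𝓙 + 𝓚)` contained in a finite set of closed points,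
`h⁰(𝒪/𝓙𝓚) + h⁰(𝒪/𝓘𝓙) + h⁰(𝒪/𝓘𝓚) = h⁰(𝒪/𝓘) + h⁰(𝒪/𝓙) + h⁰(𝒪/𝓚) + h⁰(𝒪/𝓘𝓙𝓚)` — equivalently
`⟨𝓘, 𝓙𝓚⟩ = ⟨𝓘, 𝓙⟩ + ⟨𝓘, 𝓚⟩` for `⟨𝓐, 𝓑⟩ = h⁰(𝒪/𝓐) + h⁰(𝒪/𝓑) − h⁰(𝒪/𝓐𝓑)` when these are finite.
[cite: Lipman1969, Proposition (13.1) b) and d) (p. 223)] -/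
theorem IsResolution.h0_cube_identity {A : Type u} [CommRing A] [IsNoetherianRing A] [IsLocalRing A] [IsDomain A]
    {X : Scheme.{u}} [IsIntegral X] [IsLocallyNoetherian X] (π : X ⟶ Spec (.of A)) (hA : ringKrullDim A = 2)
    (hπ : IsResolution π) (h1 : HasTrivialCechH1 π) (𝓘 𝓙 𝓚 : X.IdealSheafData) (hI : IsEffectiveCartier 𝓘)
    (hJK : 𝓙 ⊓ 𝓚 = 𝓙 * 𝓚) {Z : Set X} (hZ : Z.Finite) (hZcl : ∀ p ∈ Z, IsClosed ({p} : Set X))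
    (hsupp : ((𝓙 ⊔ 𝓚).support : Set X) ⊆ Z) :
    h0 π (𝓙 * 𝓚) + h0 π (𝓘 * 𝓙) + h0 π (𝓘 * 𝓚) =
      h0 π 𝓘 + h0 π 𝓙 + h0 π 𝓚 + h0 π (𝓘 * 𝓙 * 𝓚) := by
  haveI : IsProper π := hπ.isProper
  haveI : CompactSpace X := QuasiCompact.compactSpace_of_compactSpace π
  -- (i) inclusion–exclusion for `𝓙`, `𝓚`
  have h_i := hπ.h0_inf_add_h0_sup π hA h1 𝓙 𝓚
  rw [hJK] at h_i
  -- (ii) inclusion–exclusion for `𝓘𝓙`, `𝓘𝓚`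
  have h_ii := hπ.h0_inf_add_h0_sup π hA h1 (𝓘 * 𝓙) (𝓘 * 𝓚)
  rw [← mul_inf_eq_of_isEffectiveCartier 𝓘 𝓙 𝓚 hI, hJK, ← mul_assoc, ← Scheme.IdealSheafData.mul_inf] at h_ii
  -- (iii) the twist
  have h_iii := h0_mul_eq_add_of_finite_support π 𝓘 (𝓙 ⊔ 𝓚) hI hZ hZcl hsupp
  rw [h_iii] at h_ii
  -- combine: (ii) `h0(𝓘𝓙𝓚) + (h0 𝓘 + h0(𝓙⊔𝓚)) = h0(𝓘𝓙) + h0(𝓘𝓚)`, (i) `h0(𝓙𝓚) + h0(𝓙⊔𝓚) = h0 𝓙 + h0 𝓚`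
  calc h0 π (𝓙 * 𝓚) + h0 π (𝓘 * 𝓙) + h0 π (𝓘 * 𝓚)
      = h0 π (𝓙 * 𝓚) + (h0 π (𝓘 * 𝓙) + h0 π (𝓘 * 𝓚)) := by rw [add_assoc]
    _ = h0 π (𝓙 * 𝓚) + (h0 π (𝓘 * 𝓙 * 𝓚) + (h0 π 𝓘 + h0 π (𝓙 ⊔ 𝓚))) := by rw [h_ii]
    _ = h0 π 𝓘 + (h0 π (𝓙 * 𝓚) + h0 π (𝓙 ⊔ 𝓚)) + h0 π (𝓘 * 𝓙 * 𝓚) := by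
        simp only [add_comm, add_left_comm]
    _ = h0 π 𝓘 + (h0 π 𝓙 + h0 π 𝓚) + h0 π (𝓘 * 𝓙 * 𝓚) := by rw [h_i]
    _ = h0 π 𝓘 + h0 π 𝓙 + h0 π 𝓚 + h0 π (𝓘 * 𝓙 * 𝓚) := by simp only [add_assoc]

end Literature.AlgebraicGeometry.Resolution

end
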